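import Summits.Ventures.HodgeRepro2.T5CyclotomicSevenInertPrime
import Summits.Ventures.HodgeRepro2.T5CyclotomicSevenSplitTwo

/-!
# Every rational prime of order `3` modulo `7` gives a place of `ℚ(ζ₇)⁺` with two places of `ℚ(ζ₇)` above it

Tier-5 support N3 / §G-N4.2 (seat p3, gen 78). File 255 inhabits the split branch of the record's census on the
field of record at the prime `2`, using nothing about `2` beyond «`2` has order `3` modulo `7`». This file states it
for every rational prime `p` with `orderOf (p : ZMod 7) = 3` (`p ≡ 2, 4 (mod 7)`: `2, 11, 23, 37, 53, …`): `(p)` is a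
prime of `𝓞_{ℚ(ζ₇)⁺}` of norm `p³` with exactly two places of `ℚ(ζ₇)` above it, and `H(U(1 ⊗ H₀), K_{(p)})` is
commutative — file 255's argument verbatim with `2 ↦ p`:

* `not_dvd_seven_of_orderOf_eq_three`, `absNorm_span_natCast_plus` (`N((p)) = p³` in `𝓞_{ℚ(ζ₇)⁺}`);
* `inertiaDeg_of_liesOver_of_orderOf_eq_three`, `ramificationIdx_of_liesOver_of_orderOf_eq_three`,
  `absNorm_of_liesOver_of_orderOf_eq_three` — `f = 3`, `e = 1`, `N(P) = p³` for every prime `P` above `p`;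
* `wOf` / `vOf`, **`inertiaDeg_under_eq_one`**, `inertiaDeg_under_int`, `absNorm_under`,
  **`under_eq_span_natCast`** — the contraction of `P` IS `(p)`;
* **`isPrime_span_natCast_plus`**, `vSplit`, `absNorm_vSplit` — the place `(p)` of `ℚ(ζ₇)⁺`, `N(v) = p³`;
* `ramificationIdx_under_eq_one`, `ncard_primesOver_vOf`, **`ncard_primesOver_vSplit`**,
  `exists_ne_liesOver_vSplit` — exactly two places of `ℚ(ζ₇)` above `(p)`;
* **`heckeAlgebra_mul_comm_record_seven_split`**, `exists_generators_and_heckeAlgebra_mul_comm_record_seven_split`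
  — `H(U(1 ⊗ H₀), K_{(p)})` is commutative on `ℚ(ζ₇)` at every such place;
* the instance `p = 11`: `orderOf_eleven_zmod_seven`, `fact_prime_eleven`,
  **`isPrime_span_eleven_plus_and_ncard_primesOver`**, `absNorm_vSplit_eleven` (`N(v) = 1331`).

§8(d): uses an L-value-free non-vanishing device: NO.
-/

open Matrix NumberField NumberField.IsCMField IsDedekindDomain IsDedekindDomain.HeightOneSpectrum Module
open scoped TensorProduct Pointwise
open Summit.Ventures.HodgeRepro2.T5UnitaryGroupForm Summit.Ventures.HodgeRepro2.T5UnitaryHeckeAdjoint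
  Summit.Ventures.HodgeRepro2.T5HeckePermutationModule Summit.Ventures.HodgeRepro2.T5RecordHyperspecial
  Summit.Ventures.HodgeRepro2.T5GlobalLatticeAlmostAll Summit.Ventures.HodgeRepro2.T5FinitePlaceSplitClassification
  Summit.Ventures.HodgeRepro2.T5RecordSatakeToy Summit.Ventures.HodgeRepro2.T5RecordSatakeSplitToy
  Summit.Ventures.HodgeRepro2.T5CyclotomicSevenInertThree Summit.Ventures.HodgeRepro2.T5CMFieldSquareDatum
  Summit.Ventures.HodgeRepro2.T5FinitePlaceSplitIff Summit.Ventures.HodgeRepro2.T5SplitPlaceUnitaryGroup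
  Summit.Ventures.HodgeRepro2.T5RecordSatakeInert Summit.Ventures.HodgeRepro2.T5FinitePlaceCM
  Summit.Ventures.HodgeRepro2.T5CyclotomicSevenInertPrime Summit.Ventures.HodgeRepro2.T5CyclotomicSevenSplitTwo

namespace Summit.Ventures.HodgeRepro2.T5CyclotomicSevenSplitPrime

section Arithmetic

variable (p : ℕ) [hp : Fact p.Prime]

/-- A prime of order `3` modulo `7` is not `7` (the class of `7` is `0`, of order `0`). -/
theorem not_dvd_seven_of_orderOf_eq_three (h3 : orderOf (p : ZMod 7) = 3) : ¬ p ∣ 7 := by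
  intro hdvd
  rcases (Nat.prime_seven.eq_one_or_self_of_dvd p hdvd) with h | h
  · exact hp.out.one_lt.ne' h
  · rw [h, ZMod.natCast_self] at h3
    have h0 : orderOf (0 : ZMod 7) = 0 := orderOf_eq_zero_iff'.mpr fun n hn => by
      rw [zero_pow hn.ne']
      decide
    rw [h0] at h3
    exact absurd h3 (by norm_num)

end Arithmetic

section Seven

variable (K : Type*) [Field K] [CharZero K] [IsCyclotomicExtension {7} ℚ K]
variable (p : ℕ) [hp : Fact p.Prime] (h3 : orderOf (p : ZMod 7) = 3)

omit hp in
/-- `N((p)) = p³` in `𝓞_{ℚ(ζ₇)⁺}`. -/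
theorem absNorm_span_natCast_plus :
    haveI := numberField' K; haveI := isCMField' K
    Ideal.absNorm (Ideal.span {(p : 𝓞 (maximalRealSubfield K))}) = p ^ 3 := by
  haveI := numberField' K
  haveI := isCMField' K
  rw [Ideal.absNorm_span_natCast, RingOfIntegers.rank, finrank_rat_maximalRealSubfield_seven K]

variable (P : Ideal (𝓞 K)) [P.IsPrime] [P.LiesOver (Ideal.span {(p : ℤ)})]

include h3 in
/-- Every prime of `𝓞_{ℚ(ζ₇)}` above `p` has inertia degree `orderOf (p mod 7) = 3` (Mathlib). -/
theorem inertiaDeg_of_liesOver_of_orderOf_eq_three :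
    haveI := numberField' K
    P.inertiaDeg ℤ = 3 := by
  haveI := numberField' K
  rw [IsCyclotomicExtension.Rat.inertiaDeg_eq_of_not_dvd (m := 7) p K P (not_dvd_seven_of_orderOf_eq_three p h3),
    h3]

include h3 in
/-- Every prime of `𝓞_{ℚ(ζ₇)}` above `p` is unramified over `ℤ` (Mathlib). -/
theorem ramificationIdx_of_liesOver_of_orderOf_eq_three :
    haveI := numberField' K
    P.ramificationIdx ℤ = 1 := by
  haveI := numberField' K
  exact IsCyclotomicExtension.Rat.ramificationIdx_eq_of_not_dvd (m := 7) p K P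
    (not_dvd_seven_of_orderOf_eq_three p h3)

include h3 in
/-- Every prime of `𝓞_{ℚ(ζ₇)}` above `p` has norm `p³`. -/
theorem absNorm_of_liesOver_of_orderOf_eq_three :
    haveI := numberField' K
    Ideal.absNorm P = p ^ 3 := by
  haveI := numberField' K
  have h := Ideal.absNorm_pow_inertiaDeg (Ideal.span {(p : ℤ)}) P
  rw [absNorm_span_natCast_int, inertiaDeg_of_liesOver_of_orderOf_eq_three K p h3 P] at h
  exact h.symm

omit [CharZero K] [IsCyclotomicExtension {7} ℚ K] hp [P.IsPrime] in
/-- `p ∈ P`. -/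
theorem natCast_mem_of_liesOver : (p : 𝓞 K) ∈ P := by
  have h2 : (p : ℤ) ∈ Ideal.span {(p : ℤ)} := Ideal.mem_span_singleton_self (p : ℤ)
  rw [Ideal.mem_of_liesOver P (Ideal.span {(p : ℤ)}) p, map_natCast] at h2
  exact h2

omit [CharZero K] [IsCyclotomicExtension {7} ℚ K] hp [P.IsPrime] in
/-- `p ∈ P ∩ 𝓞_{ℚ(ζ₇)⁺}`. -/
theorem natCast_mem_under_of_liesOver :
    (p : 𝓞 (maximalRealSubfield K)) ∈ P.under (𝓞 (maximalRealSubfield K)) := by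
  rw [Ideal.mem_under, map_natCast]
  exact natCast_mem_of_liesOver K p P

/-- A prime `P` above `p` as a place of `ℚ(ζ₇)`. -/
noncomputable def wOf : HeightOneSpectrum (𝓞 K) where
  asIdeal := P
  isPrime := inferInstance
  ne_bot := fun h => by
    have h2 := natCast_mem_of_liesOver K p P
    rw [h, Ideal.mem_bot] at h2
    exact Nat.cast_ne_zero.mpr hp.out.ne_zero h2

/-- The contraction of `P` as a place of `ℚ(ζ₇)⁺`. -/
noncomputable def vOf : HeightOneSpectrum (𝓞 (maximalRealSubfield K)) where
  asIdeal := P.under (𝓞 (maximalRealSubfield K))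
  isPrime := inferInstance
  ne_bot := fun h => by
    have h2 := natCast_mem_under_of_liesOver K p P
    rw [h, Ideal.mem_bot] at h2
    exact Nat.cast_ne_zero.mpr hp.out.ne_zero h2

omit [IsCyclotomicExtension {7} ℚ K] in
/-- The ideal of `wOf`. -/
theorem wOf_asIdeal : (wOf K p P).asIdeal = P := rfl

omit [IsCyclotomicExtension {7} ℚ K] in
/-- The ideal of `vOf`. -/
theorem vOf_asIdeal : (vOf K p P).asIdeal = P.under (𝓞 (maximalRealSubfield K)) := rfl

/-- `wOf` lies over `vOf`. -/
instance liesOver_vOf : (wOf K p P).asIdeal.LiesOver (vOf K p P).asIdeal := ⟨rfl⟩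

include h3 in
/-- **`f(P/v) = 1`**: `3 = f(P/p) = f(v/p) · f(P/v)` (the tower law), so `f(P/v) ∈ {1, 3}`, and `f(P/v)` divides
the local degree `[K_P : K⁺_v]`, which divides `[K : K⁺] = 2`. -/
theorem inertiaDeg_under_eq_one :
    haveI := numberField' K; haveI := isCMField' K
    (wOf K p P).asIdeal.inertiaDeg (𝓞 (maximalRealSubfield K)) = 1 := by
  haveI := numberField' K
  haveI := isCMField' K
  have htower := Ideal.inertiaDeg_tower (R := ℤ) (vOf K p P).asIdeal (wOf K p P).asIdeal
  have h3' : (wOf K p P).asIdeal.inertiaDeg ℤ = 3 := inertiaDeg_of_liesOver_of_orderOf_eq_three K p h3 P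
  rw [h3'] at htower
  have hdvd : (wOf K p P).asIdeal.inertiaDeg (𝓞 (maximalRealSubfield K)) ∣ 3 := ⟨_, by rw [htower, mul_comm]⟩
  rcases Nat.prime_three.eq_one_or_self_of_dvd _ hdvd with h | h
  · exact h
  · exfalso
    obtain ⟨θ, y, hθ, hy⟩ := exists_sq_eq_and_complexConj_ne K
    have hef := ramificationIdx_mul_inertiaDeg_eq_finrank K (vOf K p P) (wOf K p P) hθ hy
    have h2 := ncard_primesOver_mul_finrank_eq_two K (vOf K p P) (wOf K p P) hθ hy
    have h3 : 3 ∣ 2 := by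
      refine dvd_trans ?_ ⟨_, h2.symm.trans (mul_comm _ _)⟩
      rw [← hef, h]
      exact dvd_mul_left 3 _
    norm_num at h3

include h3 in
/-- `f(v/p) = 3`. -/
theorem inertiaDeg_under_int :
    haveI := numberField' K; haveI := isCMField' K
    (vOf K p P).asIdeal.inertiaDeg ℤ = 3 := by
  haveI := numberField' K
  haveI := isCMField' K
  have htower := Ideal.inertiaDeg_tower (R := ℤ) (vOf K p P).asIdeal (wOf K p P).asIdeal
  have h3' : (wOf K p P).asIdeal.inertiaDeg ℤ = 3 := inertiaDeg_of_liesOver_of_orderOf_eq_three K p h3 P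
  rw [h3', inertiaDeg_under_eq_one K p h3 P, mul_one] at htower
  exact htower.symm

include h3 in
/-- `N(v) = p³` for the contraction `v` of a prime above `p`. -/
theorem absNorm_under :
    haveI := numberField' K; haveI := isCMField' K
    Ideal.absNorm (vOf K p P).asIdeal = p ^ 3 := by
  haveI := numberField' K
  haveI := isCMField' K
  haveI : (vOf K p P).asIdeal.LiesOver (Ideal.span {(p : ℤ)}) := by
    rw [vOf_asIdeal]
    exact Ideal.LiesOver.tower_bot P (P.under (𝓞 (maximalRealSubfield K))) (Ideal.span {(p : ℤ)})
  have h := Ideal.absNorm_pow_inertiaDeg (Ideal.span {(p : ℤ)}) (vOf K p P).asIdeal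
  rw [absNorm_span_natCast_int, inertiaDeg_under_int K p h3 P] at h
  exact h.symm

include h3 in
/-- **The contraction of every prime above `p` is `(p)`**: `(p) ≤ v` and both have norm `p³`. -/
theorem under_eq_span_natCast :
    haveI := numberField' K; haveI := isCMField' K
    (vOf K p P).asIdeal = Ideal.span {(p : 𝓞 (maximalRealSubfield K))} := by
  haveI := numberField' K
  haveI := isCMField' K
  refine (eq_of_le_of_absNorm_eq ?_
    ((Ideal.span_singleton_eq_bot).not.mpr (Nat.cast_ne_zero.mpr hp.out.ne_zero)) ?_).symm
  · rw [Ideal.span_le, Set.singleton_subset_iff, SetLike.mem_coe, vOf_asIdeal]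
    exact natCast_mem_under_of_liesOver K p P
  · rw [absNorm_span_natCast_plus K p, absNorm_under K p h3 P]

end Seven

section Place

variable (K : Type*) [Field K] [CharZero K] [IsCyclotomicExtension {7} ℚ K]
variable (p : ℕ) [hp : Fact p.Prime] (h3 : orderOf (p : ZMod 7) = 3)

include h3 in
/-- **`(p)` is a prime of `𝓞_{ℚ(ζ₇)⁺}`** for `p` of order `3` modulo `7`: it is the contraction of any prime of
`𝓞_{ℚ(ζ₇)}` above `p`. -/
theorem isPrime_span_natCast_plus :
    haveI := numberField' K; haveI := isCMField' K
    (Ideal.span {(p : 𝓞 (maximalRealSubfield K))}).IsPrime := by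
  haveI := numberField' K
  haveI := isCMField' K
  haveI : (Ideal.span {(p : ℤ)}).IsPrime :=
    (Ideal.span_singleton_prime (Nat.cast_ne_zero.mpr hp.out.ne_zero)).mpr (Nat.prime_iff_prime_int.mp hp.out)
  obtain ⟨⟨P, hP, hPo⟩⟩ := Ideal.nonempty_primesOver (S := 𝓞 K) (Ideal.span {(p : ℤ)})
  rw [← under_eq_span_natCast K p h3 P]
  exact (vOf K p P).isPrime

/-- **The place `(p)` of `ℚ(ζ₇)⁺`** for a prime `p` of order `3` modulo `7`. -/
noncomputable def vSplit : HeightOneSpectrum (𝓞 (maximalRealSubfield K)) :=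
  haveI := numberField' K
  haveI := isCMField' K
  { asIdeal := Ideal.span {(p : 𝓞 (maximalRealSubfield K))}
    isPrime := isPrime_span_natCast_plus K p h3
    ne_bot := (Ideal.span_singleton_eq_bot).not.mpr (Nat.cast_ne_zero.mpr hp.out.ne_zero) }

/-- The ideal of `vSplit` is `(p)`. -/
theorem vSplit_asIdeal : (vSplit K p h3).asIdeal = Ideal.span {(p : 𝓞 (maximalRealSubfield K))} := rfl

/-- `N(vSplit) = p³`. -/
theorem absNorm_vSplit :
    haveI := numberField' K; haveI := isCMField' K
    Ideal.absNorm (vSplit K p h3).asIdeal = p ^ 3 := by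
  haveI := numberField' K
  haveI := isCMField' K
  rw [vSplit_asIdeal]
  exact absNorm_span_natCast_plus K p

variable (P : Ideal (𝓞 K)) [P.IsPrime] [P.LiesOver (Ideal.span {(p : ℤ)})]

include h3 in
/-- **`e(P/v) = 1`**: `1 = e(P/p) = e(v/p) · e(P/v)` (the tower law, `𝓞_{ℚ(ζ₇)}` being flat over the Dedekind domain
`𝓞_{ℚ(ζ₇)⁺}`). -/
theorem ramificationIdx_under_eq_one :
    haveI := numberField' K; haveI := isCMField' K
    (wOf K p P).asIdeal.ramificationIdx (𝓞 (maximalRealSubfield K)) = 1 := by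
  haveI := numberField' K
  haveI := isCMField' K
  have htower := Ideal.ramificationIdx_tower (R := ℤ) (vOf K p P).asIdeal (wOf K p P).asIdeal
  have h1 : (wOf K p P).asIdeal.ramificationIdx ℤ = 1 := ramificationIdx_of_liesOver_of_orderOf_eq_three K p h3 P
  rw [h1] at htower
  exact Nat.eq_one_of_mul_eq_one_left htower.symm

include h3 in
/-- **Exactly two places of `ℚ(ζ₇)` above the contraction of a prime above `p`**: the local degree
`[K_P : K⁺_v] = e(P/v) f(P/v) = 1`, and a local degree `1` means two places (file T5FinitePlaceSplitIff). -/
theorem ncard_primesOver_vOf :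
    haveI := numberField' K; haveI := isCMField' K
    ((vOf K p P).asIdeal.primesOver (𝓞 K)).ncard = 2 := by
  haveI := numberField' K
  haveI := isCMField' K
  obtain ⟨θ, y, hθ, hy⟩ := exists_sq_eq_and_complexConj_ne K
  refine (finrank_eq_one_iff_ncard_primesOver_eq_two K (vOf K p P) (wOf K p P) hθ hy).mp ?_
  rw [← ramificationIdx_mul_inertiaDeg_eq_finrank K (vOf K p P) (wOf K p P) hθ hy,
    ramificationIdx_under_eq_one K p h3 P, inertiaDeg_under_eq_one K p h3 P]

omit P in
include h3 in
/-- **Exactly two places of `ℚ(ζ₇)` above `(p)`.** -/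
theorem ncard_primesOver_vSplit :
    haveI := numberField' K; haveI := isCMField' K
    ((vSplit K p h3).asIdeal.primesOver (𝓞 K)).ncard = 2 := by
  haveI := numberField' K
  haveI := isCMField' K
  haveI : (Ideal.span {(p : ℤ)}).IsPrime :=
    (Ideal.span_singleton_prime (Nat.cast_ne_zero.mpr hp.out.ne_zero)).mpr (Nat.prime_iff_prime_int.mp hp.out)
  obtain ⟨⟨P, hP, hPo⟩⟩ := Ideal.nonempty_primesOver (S := 𝓞 K) (Ideal.span {(p : ℤ)})
  rw [vSplit_asIdeal, ← under_eq_span_natCast K p h3 P]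
  exact ncard_primesOver_vOf K p h3 P

omit P in
include h3 in
/-- Two distinct places of `ℚ(ζ₇)` lie over `vSplit`. -/
theorem exists_ne_liesOver_vSplit :
    haveI := numberField' K; haveI := isCMField' K
    ∃ w₁ w₂ : HeightOneSpectrum (𝓞 K), w₁ ≠ w₂ ∧ w₁.asIdeal.LiesOver (vSplit K p h3).asIdeal ∧
      w₂.asIdeal.LiesOver (vSplit K p h3).asIdeal := by
  haveI := numberField' K
  haveI := isCMField' K
  obtain ⟨x, z, hxz, hs⟩ := Set.ncard_eq_two.mp (ncard_primesOver_vSplit K p h3)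
  have hx : x ∈ (vSplit K p h3).asIdeal.primesOver (𝓞 K) := by rw [hs]; exact Set.mem_insert x _
  have hz : z ∈ (vSplit K p h3).asIdeal.primesOver (𝓞 K) := by rw [hs]; exact Set.mem_insert_of_mem x rfl
  haveI := hx.1
  haveI := hx.2
  haveI := hz.1
  haveI := hz.2
  refine ⟨⟨x, hx.1, Ideal.ne_bot_of_liesOver_of_ne_bot (vSplit K p h3).ne_bot x⟩,
    ⟨z, hz.1, Ideal.ne_bot_of_liesOver_of_ne_bot (vSplit K p h3).ne_bot z⟩, ?_, hx.2, hz.2⟩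
  intro h
  exact hxz (congrArg HeightOneSpectrum.asIdeal h)

omit P in
include h3 in
/-- **THE RECORD'S SPHERICAL HECKE ALGEBRA ON `ℚ(ζ₇)` AT EVERY SPLIT PLACE `(p)` IS COMMUTATIVE**: for every family
`l` of generators of `𝓞_{ℚ(ζ₇)}` over `𝓞_{ℚ(ζ₇)⁺}` and every field `k`, `H(U(1 ⊗ H₀), K_{(p)})` is commutative
(file 250's `heckeAlgebra_mul_comm_record_of_ne_of_liesOver` on the two places above `(p)`). -/
theorem heckeAlgebra_mul_comm_record_seven_split (k : Type*) [Field k] {r : ℕ} (l : Fin r → 𝓞 K)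
    (hl : Submodule.span (𝓞 (maximalRealSubfield K)) (Set.range l) = ⊤)
    (T S : (haveI := numberField' K; haveI := isCMField' K; letI := tensorStarRing K (vSplit K p h3);
      ↥(heckeAlgebra k (recordHyperspecial K (vSplit K p h3) l (gramToy K))))) :
    T * S = S * T :=
  haveI := numberField' K
  haveI := isCMField' K
  (exists_ne_liesOver_vSplit K p h3).elim fun w₁ h => h.elim fun w₂ h =>
    @heckeAlgebra_mul_comm_record_of_ne_of_liesOver K _ (numberField' K) (isCMField' K) (vSplit K p h3) w₁ w₂ _
      l k _ hl h.1 h.2.1 h.2.2 _ _ _ _ gramToy_isHermitian isUnit_det_gramToy (notMem_badSet_gramToy _) T S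

omit P in
include h3 in
/-- **With the generators supplied** (file 235's `exists_fin_span_eq_top`): the split branch of the census is
inhabited on the field of record at every such place. -/
theorem exists_generators_and_heckeAlgebra_mul_comm_record_seven_split (k : Type*) [Field k] :
    haveI := numberField' K; haveI := isCMField' K
    ∃ (r : ℕ) (l : Fin r → 𝓞 K), Submodule.span (𝓞 (maximalRealSubfield K)) (Set.range l) = ⊤ ∧
      ∀ T S : (letI := tensorStarRing K (vSplit K p h3);
          ↥(heckeAlgebra k (recordHyperspecial K (vSplit K p h3) l (gramToy K)))), T * S = S * T :=
  haveI := numberField' K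
  haveI := isCMField' K
  (exists_fin_span_eq_top K).elim fun r h => h.elim fun l hl =>
    ⟨r, l, hl, fun T S => heckeAlgebra_mul_comm_record_seven_split K p h3 k l hl T S⟩

end Place


section Eleven

variable (K : Type*) [Field K] [CharZero K] [IsCyclotomicExtension {7} ℚ K]

/-- `11` has multiplicative order `3` modulo `7`. -/
theorem orderOf_eleven_zmod_seven : orderOf (11 : ZMod 7) = 3 := by
  rw [orderOf_eq_iff (by norm_num)]
  decide

/-- `orderOf ((11 : ℕ) : ZMod 7) = 3` (the cast form used by the generic theorems). -/
theorem orderOf_natCast_eleven_zmod_seven : orderOf ((11 : ℕ) : ZMod 7) = 3 := by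
  rw [Nat.cast_ofNat]
  exact orderOf_eleven_zmod_seven

/-- `11` is prime (as a `Fact`, for the generic theorems). -/
theorem fact_prime_eleven : Fact (Nat.Prime 11) := ⟨by norm_num⟩

/-- **`(11)` is a prime of `𝓞_{ℚ(ζ₇)⁺}`** with exactly two places of `ℚ(ζ₇)` above it — the second instance of the
split family (`p = 2` is file 255). -/
theorem isPrime_span_eleven_plus_and_ncard_primesOver :
    haveI := numberField' K; haveI := isCMField' K; haveI := fact_prime_eleven
    (Ideal.span {(11 : 𝓞 (maximalRealSubfield K))}).IsPrime ∧
      ((vSplit K 11 orderOf_natCast_eleven_zmod_seven).asIdeal.primesOver (𝓞 K)).ncard = 2 := by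
  haveI := numberField' K
  haveI := isCMField' K
  haveI := fact_prime_eleven
  refine ⟨?_, ncard_primesOver_vSplit K 11 orderOf_natCast_eleven_zmod_seven⟩
  have h := isPrime_span_natCast_plus K 11 orderOf_natCast_eleven_zmod_seven
  rwa [Nat.cast_ofNat] at h

/-- `N(vSplit 11) = 1331`. -/
theorem absNorm_vSplit_eleven :
    haveI := numberField' K; haveI := isCMField' K; haveI := fact_prime_eleven
    Ideal.absNorm (vSplit K 11 orderOf_natCast_eleven_zmod_seven).asIdeal = 1331 := by
  haveI := numberField' K
  haveI := isCMField' K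
  haveI := fact_prime_eleven
  rw [absNorm_vSplit K 11 orderOf_natCast_eleven_zmod_seven]
  norm_num

end Eleven

end Summit.Ventures.HodgeRepro2.T5CyclotomicSevenSplitPrime
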